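import Summits.BirchSwinnertonDyer.BirchSwinnertonDyer.Theorems.EisensteinPrimesAcTwistDeformationCurveSUR
import Summits.BirchSwinnertonDyer.BirchSwinnertonDyer.Theorems.SignedBaseChangeAnticyclotomicEisensteinDivisibilityGreenbergFullAtSqueezeOfTate
import Literature.NumberTheory.IwasawaTheory.Greenberg2006.CohomologyCofiniteGenerationLeTwoOfTate
import HarnessLib

/-!
# T28 re-typing (`OfTate`) of `EisensteinPrimesAcTwistDeformationCurveSUR.lean`

Route `EisensteinPrimes` (rung K5), crux 2 `GoodLatticeBDPValue` (stmt-BirchSwinnertonDyer-19032), line `halves`;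
cell `bsd-eis`, seat `bsd-line-x1-p1` LEAD g8, lane «T28 / TATE RE-PLUMB» (helper, `--supports`).

This file re-types, token for token, the theorems of `EisensteinPrimesAcTwistDeformationCurveSUR` that carry
Greenberg 2006 Prop. 3.2 BY NAME (`h32 : (∀ (L : Type) [Field L] [NumberField L], Literature.NumberTheory.GaloisCohomology.tateGlobalEulerPoincareCharacteristic L)`, cofinite generation of
`Hⁱ(K_Σ/K, 𝒟)` / `Hⁱ(K_v, 𝒟)` for EVERY `i`, every number field, every prime) with that hypothesis replaced by
Tate's global Euler–Poincaré characteristic BY NAME for every number field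
(`h32 : ∀ L, GaloisCohomology.tateGlobalEulerPoincareCharacteristic L`, Milne ADT I Thm. 5.1): on this line
Prop. 3.2 is read in degrees `i ≤ 2` only (global clause; the local clause is the unconditional
`Greenberg2006.prop32_local_holds`), and in those degrees it follows from Tate's formula alone
(`Greenberg2006.prop32_global_le_two_of_tate`, file `CohomologyCofiniteGenerationLeTwoOfTate`: `H⁰`/`H¹` of
`G_{K,S}` with finite coefficients are finite unconditionally, `H²` by Tate, and Greenberg's dévissage for `Hⁿ`
involves `Hⁿ`, `Hⁿ⁻¹` only).  Statements are otherwise VERBATIM (same binder order, new names `<name>_ofTate`);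
proofs are the tree proofs with the two reading lemmas substituted and the re-typed callees called.
EFFECT for the crux: Harari Thm. 17.13 (a) (`poitouTate_restricted_three_le`) is no longer consumed through
Prop. 3.2 at every number field, only at totally complex fields (Greenberg 2006 Prop. 4.1 is typed totally
imaginary; `cd_p ≤ 2` and the `H²` bookkeeping at the imaginary quadratic `K`), which is what the tree's
class-formation road (`RestrictedRamificationCdTwoOfH3Mu`, lane PT3-TC) proves.

Theorems only; no definition, no named fact, no `sorry`, no instance. HONEST FRAMING: conditional on the PUBLISHED
named facts carried as hypotheses; closes nothing by itself; no summit statement / BSD / the crux is proved here.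

## References
* R. Greenberg, *On the structure of certain Galois cohomology groups*, Doc. Math. Extra Vol. Coates (2006), Prop. 3.2 (p. 358). [Greenberg2006]
* J. S. Milne, *Arithmetic Duality Theorems*, 2nd ed. (2006), I Thm. 5.1 (p. 67). [MilneADT2006]
* (the references of the re-typed file apply verbatim)
-/

set_option autoImplicit false

noncomputable section

open scoped Classical
open NumberField IsDedekindDomain Field Finset
open Literature.NumberTheory.EllipticCurves Literature.NumberTheory.GaloisRepresentations
  Literature.NumberTheory.IwasawaTheory Literature.NumberTheory.IwasawaTheory.Greenberg2016
  Literature.NumberTheory.IwasawaTheory.Greenberg2006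
  Summit.BirchSwinnertonDyer.BirchSwinnertonDyer.Theorems.TwistDeformationCofree
  Summit.BirchSwinnertonDyer.BirchSwinnertonDyer.Theorems.GreenbergFullAtSelmer
  Summit.BirchSwinnertonDyer.BirchSwinnertonDyer.Theorems.SignedBaseChangeAcDivGreenbergSqueeze

namespace Summit.BirchSwinnertonDyer.BirchSwinnertonDyer.Theorems.AcTwistDeformation

section DualBasisForm

variable {K : Type} [Field K] [NumberField K] {S : Set (HeightOneSpectrum (𝓞 K))} {p : ℕ} [Fact p.Prime]
  {A : Type} [AddCommGroup A] [Module ℤ_[p] A] [TopologicalSpace A] [DiscreteTopology A]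
  [TopologicalSpace (PowerSeries ℤ_[p])] [IsTopologicalRing (PowerSeries ℤ_[p])]
  [IsTopologicalAddGroup (BigRepModule ℤ_[p] p A)]
  [ContinuousSMul (PowerSeries ℤ_[p]) (BigRepModule ℤ_[p] p A)]
  (hS : ∀ v : HeightOneSpectrum (𝓞 K), ((p : ℕ) : 𝓞 K) ∈ v.asIdeal → v ∈ S)
  (κ : ZpExtension K p) (ρ₀ : ContinuousRep (GaloisGroupUnramifiedOutside K S) ℤ_[p] A) {n : ℕ}

/-- **[T28 `OfTate` re-typing: Greenberg 2006 Prop. 3.2 by name ↦ Milne ADT I Thm. 5.1 by name (Prop. 3.2 is read in degrees ≤ 2 only, `prop32_global_le_two_of_tate`).]** [cite: MilneADT2006, I Thm. 5.1 (p. 67)] **LEO(`𝐃`) ∧ CRK(`𝐃`, `𝓛_𝔭`) ∧ `corank H¹(K_Σ/K, 𝐃) = n` ∧ `corank H²(K_Σ/K, 𝐃) = 0` for the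
one-variable twist deformation `𝐃 = bigRep κ ρ₀` of a `p`-primary `A` with a rank-`n` Pontryagin DUAL-BASIS
FAMILY** over a `ℤ_p`-extension of an IMAGINARY QUADRATIC `K` with `p = 𝔭𝔭̄` split, granted Greenberg 2006 Props. 4.1, 4.2, §5 A, 3.2 by name, `h⁰ = 0` and
LOC⁽¹⁾ at the places of `S`, and `corank_Λ S_{𝓛_𝔭}(K, 𝐃) = 0`: the corank-`n` arena (`…CofreeRank`, dual-basis form) fed to
cell `bsd-ssimc`'s generic squeeze `leo_and_crk_fullAt_of_squeeze_ofTate` (the global `h⁰ = 0` from the local one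
at `𝔭`). The `h² = 0` conjunct is the weak-Leopoldt input WL of the index road (over `K`).
[cite: Greenberg2006, Props. 4.1–4.2 (§4 A pp. 367–368), §5 A, Prop. 3.2] [cite: Greenberg2016Selmer, §2.2–2.3 pp. 6–7] -/
theorem bigRep_leo_crk_of_dualBasis_ofTate (h41 : prop41_globalEulerPoincareCorank)
    (h42 : prop42_localEulerPoincareCorank) (h5A : sec5A_localH2_subsingleton_of_LOC1)
    (h32 : (∀ (L : Type) [Field L] [NumberField L], Literature.NumberTheory.GaloisCohomology.tateGlobalEulerPoincareCharacteristic L))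
    (hSf : S.Finite) (hK : IsImaginaryQuadratic K) (hA : ∀ a : A, ∃ k : ℕ, p ^ k • a = 0)
    (jQ : Fin n → (A →+ AddCircle (1 : ℚ)))
    (hinjQ : ∀ c : Fin n → ℤ_[p], (∀ a : A, ∑ k, jQ k (c k • a) = 0) → c = 0)
    (hsurjQ : ∀ φ : A →+ AddCircle (1 : ℚ), ∃ c : Fin n → ℤ_[p], ∀ a : A, φ a = ∑ k, jQ k (c k • a))
    (h0loc : ∀ v : HeightOneSpectrum (𝓞 K), v ∈ S →
      HasCorank (PowerSeries ℤ_[p])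
        ((localRep S (bigRep (κ.liftUnramifiedOutside S hS) ρ₀) (Sum.inr v)).H 0) 0)
    (hLOC1fin : ∀ v : HeightOneSpectrum (𝓞 K), v ∈ S →
      LOC1 S (bigRep (κ.liftUnramifiedOutside S hS) ρ₀) (Sum.inr v))
    {𝔭 𝔭bar : HeightOneSpectrum (𝓞 K)} (hne : 𝔭bar ≠ 𝔭)
    (hp𝔭 : ((p : ℕ) : 𝓞 K) ∈ 𝔭.asIdeal) (hp𝔭bar : ((p : ℕ) : 𝓞 K) ∈ 𝔭bar.asIdeal)
    (hSel : HasCorank (PowerSeries ℤ_[p])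
      (fullAtSpecification S (bigRep (κ.liftUnramifiedOutside S hS) ρ₀) (Sum.inr 𝔭)).selmer 0) :
    LEO S (bigRep (κ.liftUnramifiedOutside S hS) ρ₀) ∧
      (fullAtSpecification S (bigRep (κ.liftUnramifiedOutside S hS) ρ₀) (Sum.inr 𝔭)).CRK ∧
      HasCorank (PowerSeries ℤ_[p]) ((bigRep (κ.liftUnramifiedOutside S hS) ρ₀).H 1) n ∧
      HasCorank (PowerSeries ℤ_[p]) ((bigRep (κ.liftUnramifiedOutside S hS) ρ₀).H 2) 0 := by
  set ρ := bigRep (κ.liftUnramifiedOutside S hS) ρ₀ with hρ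
  have hΛ := nonempty_iwasawaAlgebra_ringEquiv_mvPowerSeries p
  -- the instance data from the dual basis
  have hcf := isCofinitelyGenerated_bigRepModule_pi hA jQ hinjQ hsurjQ
  have hm := hasCorank_bigRepModule_pi hA jQ hinjQ hsurjQ
  have hpD : ∀ d : BigRepModule ℤ_[p] p A, ∃ n : ℕ, (p ^ n : ℤ) • d = 0 := exists_zpow_smul_eq_zero
  -- `K` imaginary quadratic, `p` split
  haveI := hK.2
  have hKc : ∀ w : InfinitePlace K, w.IsComplex := IsTotallyComplex.isComplex
  have hr₂ := nrComplexPlaces_eq_one_of_isImaginaryQuadratic hK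
  have hdeg : 𝔭bar.asIdeal.ramificationIdx ℤ * 𝔭bar.asIdeal.inertiaDeg ℤ = 1 :=
    (ncard_primesOver_eq_two_and_deg_one_of_ne hK.1 hp𝔭 hp𝔭bar hne).2 hp𝔭bar
  have hSp : ∀ v : HeightOneSpectrum (𝓞 K), v ∈ S → ((p : ℕ) : 𝓞 K) ∈ v.asIdeal →
      v = 𝔭 ∨ v = 𝔭bar := fun v _ hv ↦ eq_or_eq_of_natCast_mem_of_ne hK.1 hp𝔭 hp𝔭bar hne hv
  -- global `h⁰ = 0` from the local one at `𝔭`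
  have h0 : HasCorank (PowerSeries ℤ_[p]) (ρ.H 0) 0 :=
    hasCorank_H0_zero_of_local ρ (Sum.inr 𝔭) (prop32_local_of_holds hSf hS hΛ ρ hpD hcf (Sum.inr 𝔭) 0)
      (h0loc 𝔭 (hS 𝔭 hp𝔭))
  exact leo_and_crk_fullAt_of_squeeze_ofTate ρ h41 h42 h32 h5A hSf hS hKc hr₂ hΛ hpD hcf hm h0 (hS 𝔭bar hp𝔭bar)
    hne hp𝔭bar hdeg hSp hLOC1fin h0loc hSel

/-- **[T28 `OfTate` re-typing: Greenberg 2006 Prop. 3.2 by name ↦ Milne ADT I Thm. 5.1 by name (Prop. 3.2 is read in degrees ≤ 2 only, `prop32_global_le_two_of_tate`).]** [cite: MilneADT2006, I Thm. 5.1 (p. 67)] **SUR(`𝐃`, `𝓛_𝔭`) — Greenberg 2016 Prop. 2.6.3 (c) for the one-variable twist deformation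
`𝐃 = bigRep κ ρ₀` of a `p`-primary `A` with a rank-`n` Pontryagin dual-basis family** (e.g. `A = E[p^∞]`, `n = 2`) over a `ℤ_p`-extension `κ` of an
IMAGINARY QUADRATIC `K` with `p = 𝔭𝔭̄` split: the global-to-local map
`φ_{𝓛_𝔭} : H¹(K_Σ/K, 𝐃) → ∏_{w∈Σ} H¹(K_w, 𝐃)/L_w` (`L_𝔭 = ⊤`, `L_w = 0` for `w ≠ 𝔭`) IS SURJECTIVE, GRANTED
five published facts by name (Greenberg 2016 Prop. 2.6.3; Greenberg 2006 Props. 4.1, 4.2, §5 A, 3.2),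
`h⁰ = 0` and LOC⁽¹⁾ at the places of `S`, and `corank_Λ S_{𝓛_𝔭}(K, 𝐃) = 0`. DISCHARGED here: `𝐃` divisible / cofree /
corank `n` / `p`-primary (`…CofreeRank`); LEO and CRK by the squeeze (`bigRep_leo_crk_of_dualBasis_ofTate`); condition (c)
at `𝔭` (`Q_𝔭 = 0`).
[cite: Greenberg2016Selmer, Prop. 2.6.3 (c) (§2.6 p. 10 L13–22), §4.3 p. 20 L19–30]
[cite: Greenberg2010, Prop. 3.2.1 (p. 15)] [cite: Greenberg2006, Prop. 3.2 p. 358, Props. 4.1–4.2 (§4 A pp. 367–368), §5 A (p. 373)] -/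
theorem bigRep_fullAt_SUR_of_dualBasis_ofTate (h263 : prop263_sur_of_crk) (h41 : prop41_globalEulerPoincareCorank)
    (h42 : prop42_localEulerPoincareCorank) (h5A : sec5A_localH2_subsingleton_of_LOC1)
    (h32 : (∀ (L : Type) [Field L] [NumberField L], Literature.NumberTheory.GaloisCohomology.tateGlobalEulerPoincareCharacteristic L))
    (hSf : S.Finite) (hK : IsImaginaryQuadratic K) (hA : ∀ a : A, ∃ k : ℕ, p ^ k • a = 0)
    (jQ : Fin n → (A →+ AddCircle (1 : ℚ)))
    (hinjQ : ∀ c : Fin n → ℤ_[p], (∀ a : A, ∑ k, jQ k (c k • a) = 0) → c = 0)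
    (hsurjQ : ∀ φ : A →+ AddCircle (1 : ℚ), ∃ c : Fin n → ℤ_[p], ∀ a : A, φ a = ∑ k, jQ k (c k • a))
    (h0loc : ∀ v : HeightOneSpectrum (𝓞 K), v ∈ S →
      HasCorank (PowerSeries ℤ_[p])
        ((localRep S (bigRep (κ.liftUnramifiedOutside S hS) ρ₀) (Sum.inr v)).H 0) 0)
    (hLOC1fin : ∀ v : HeightOneSpectrum (𝓞 K), v ∈ S →
      LOC1 S (bigRep (κ.liftUnramifiedOutside S hS) ρ₀) (Sum.inr v))
    {𝔭 𝔭bar : HeightOneSpectrum (𝓞 K)} (hne : 𝔭bar ≠ 𝔭)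
    (hp𝔭 : ((p : ℕ) : 𝓞 K) ∈ 𝔭.asIdeal) (hp𝔭bar : ((p : ℕ) : 𝓞 K) ∈ 𝔭bar.asIdeal)
    (hSel : HasCorank (PowerSeries ℤ_[p])
      (fullAtSpecification S (bigRep (κ.liftUnramifiedOutside S hS) ρ₀) (Sum.inr 𝔭)).selmer 0) :
    (fullAtSpecification S (bigRep (κ.liftUnramifiedOutside S hS) ρ₀) (Sum.inr 𝔭)).SUR := by
  set ρ := bigRep (κ.liftUnramifiedOutside S hS) ρ₀ with hρ
  -- standing clauses of the arena at `Λ = R = ℤ_p⟦T⟧`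
  have hΛ := nonempty_iwasawaAlgebra_ringEquiv_mvPowerSeries p
  have hcpl := isAdicComplete_maximalIdeal_iwasawaAlgebra p
  have hres := finite_residueField_iwasawaAlgebra p
  have hchar := charP_residueField_iwasawaAlgebra p
  have hinjΛ : Function.Injective (algebraMap (PowerSeries ℤ_[p]) (PowerSeries ℤ_[p])) :=
    fun a b h ↦ by simpa using h
  have hfin : Module.Finite (PowerSeries ℤ_[p]) (PowerSeries ℤ_[p]) := inferInstance
  have hlin : ∀ (g : GaloisGroupUnramifiedOutside K S) (r : PowerSeries ℤ_[p])
      (d : BigRepModule ℤ_[p] p A), ρ g (r • d) = r • ρ g d := fun g r d ↦ map_smul (ρ g) r d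
  -- the instance data from the dual basis
  have hdiv := isDivisible_bigRepModule_pi hA jQ hinjQ hsurjQ
  have hT := isCofree_bigRepModule_pi hA jQ hinjQ hsurjQ
  have hpD : ∀ d : BigRepModule ℤ_[p] p A, ∃ n : ℕ, (p ^ n : ℤ) • d = 0 := exists_zpow_smul_eq_zero
  -- the squeeze: LEO, CRK
  obtain ⟨hLEO, hCRK, -, -⟩ := bigRep_leo_crk_of_dualBasis_ofTate hS κ ρ₀ h41 h42 h5A h32 hSf hK hA jQ hinjQ hsurjQ
    h0loc hLOC1fin hne hp𝔭 hp𝔭bar hSel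
  -- condition (c) at `η = 𝔭`: LOC⁽¹⁾ and `Q_𝔭 = 0` divisible
  have hQ𝔭 : IsDivisible (PowerSeries ℤ_[p]) ((fullAtSpecification S ρ (Sum.inr 𝔭)).Q (Sum.inr 𝔭)) := by
    haveI : Subsingleton ((fullAtSpecification S ρ (Sum.inr 𝔭)).Q (Sum.inr 𝔭)) :=
      Submodule.Quotient.subsingleton_iff.mpr (fullAtSpecification_self (Sum.inr 𝔭))
    exact fun θ _ s ↦ ⟨s, Subsingleton.elim _ _⟩
  -- Prop. 2.6.3 (c)
  exact h263 p K S hSf hS (PowerSeries ℤ_[p]) 1 hΛ (PowerSeries ℤ_[p]) hinjΛ hfin hcpl hres hchar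
    (BigRepModule ℤ_[p] p A) ρ hlin hT hpD (fullAtSpecification S ρ (Sum.inr 𝔭))
    (fullAtSpecification_isStable (Sum.inr 𝔭) hlin) hdiv hLEO hCRK
    (Or.inr (Or.inr ⟨𝔭, hS 𝔭 hp𝔭, hLOC1fin 𝔭 (hS 𝔭 hp𝔭), hQ𝔭⟩))

end DualBasisForm

section CurveLocal

variable {K : Type} [Field K] [NumberField K] (S : Set (HeightOneSpectrum (𝓞 K))) {p : ℕ} [Fact p.Prime]
  (W : WeierstrassCurve K) [W.IsElliptic]
  [TopologicalSpace (PowerSeries ℤ_[p])]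
  [IsTopologicalAddGroup (BigRepModule ℤ_[p] p (PrimaryTorsion W.geomPoints p))]
  [ContinuousSMul (PowerSeries ℤ_[p]) (BigRepModule ℤ_[p] p (PrimaryTorsion W.geomPoints p))]
  (hS : ∀ v : HeightOneSpectrum (𝓞 K), ((p : ℕ) : 𝓞 K) ∈ v.asIdeal → v ∈ S)
  (κ : ZpExtension K p)
  (ρ₀ : ContinuousRep (GaloisGroupUnramifiedOutside K S) ℤ_[p] (PrimaryTorsion W.geomPoints p))

end CurveLocal

section CurveSUR

variable {K : Type} [Field K] [NumberField K] {S : Set (HeightOneSpectrum (𝓞 K))} {p : ℕ} [Fact p.Prime]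
  (W : WeierstrassCurve K) [W.IsElliptic]
  [TopologicalSpace (PowerSeries ℤ_[p])] [IsTopologicalRing (PowerSeries ℤ_[p])]
  [IsTopologicalAddGroup (BigRepModule ℤ_[p] p (PrimaryTorsion W.geomPoints p))]
  [ContinuousSMul (PowerSeries ℤ_[p]) (BigRepModule ℤ_[p] p (PrimaryTorsion W.geomPoints p))]
  (hS : ∀ v : HeightOneSpectrum (𝓞 K), ((p : ℕ) : 𝓞 K) ∈ v.asIdeal → v ∈ S)
  (κ : ZpExtension K p)
  (ρ₀ : ContinuousRep (GaloisGroupUnramifiedOutside K S) ℤ_[p] (PrimaryTorsion W.geomPoints p))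

/-- **[T28 `OfTate` re-typing: Greenberg 2006 Prop. 3.2 by name ↦ Milne ADT I Thm. 5.1 by name (Prop. 3.2 is read in degrees ≤ 2 only, `prop32_global_le_two_of_tate`).]** [cite: MilneADT2006, I Thm. 5.1 (p. 67)] **LEO(`𝐃_E`) ∧ CRK(`𝐃_E`, `𝓛_𝔭`) ∧ `corank H¹(K_Σ/K, 𝐃_E) = 2` ∧ `corank H²(K_Σ/K, 𝐃_E) = 0`** for
`𝐃_E = E[p^∞] ⊗ Λ^*(κ⁻¹)` over a `ℤ_p`-extension `κ` of an IMAGINARY QUADRATIC `K` with `p = 𝔭𝔭̄`, in which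
no place of the finite `S ⊇ {w ∣ p}` splits completely, granted Greenberg 2006 Props. 4.1, 4.2, §5 A, 3.2
by name and `corank_Λ S_{𝓛_𝔭}(K, 𝐃_E) = 0`. The `h² = 0` conjunct is WL_f of the index road, over `K`.
[cite: Greenberg2006, Props. 4.1–4.2 (§4 A pp. 367–368), §5 A, Prop. 3.2] [cite: Greenberg2016Selmer, §2.2–2.3 pp. 6–7, §4.3 p. 20] -/
theorem primaryTorsion_leo_h2_ofTate (h41 : prop41_globalEulerPoincareCorank)
    (h42 : prop42_localEulerPoincareCorank) (h5A : sec5A_localH2_subsingleton_of_LOC1)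
    (h32 : (∀ (L : Type) [Field L] [NumberField L], Literature.NumberTheory.GaloisCohomology.tateGlobalEulerPoincareCharacteristic L))
    (hSf : S.Finite) (hK : IsImaginaryQuadratic K)
    (hsup : ∀ v : HeightOneSpectrum (𝓞 K), v ∈ S →
      ∃ σ : absoluteGaloisGroup (Place.Completion (Sum.inr v : Place K)),
        κ (absGaloisRestrict K _ σ) ≠ 1)
    {𝔭 𝔭bar : HeightOneSpectrum (𝓞 K)} (hne : 𝔭bar ≠ 𝔭)
    (hp𝔭 : ((p : ℕ) : 𝓞 K) ∈ 𝔭.asIdeal) (hp𝔭bar : ((p : ℕ) : 𝓞 K) ∈ 𝔭bar.asIdeal)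
    (hSel : HasCorank (PowerSeries ℤ_[p])
      (fullAtSpecification S (bigRep (κ.liftUnramifiedOutside S hS) ρ₀) (Sum.inr 𝔭)).selmer 0) :
    LEO S (bigRep (κ.liftUnramifiedOutside S hS) ρ₀) ∧
      (fullAtSpecification S (bigRep (κ.liftUnramifiedOutside S hS) ρ₀) (Sum.inr 𝔭)).CRK ∧
      HasCorank (PowerSeries ℤ_[p]) ((bigRep (κ.liftUnramifiedOutside S hS) ρ₀).H 1) 2 ∧
      HasCorank (PowerSeries ℤ_[p]) ((bigRep (κ.liftUnramifiedOutside S hS) ρ₀).H 2) 0 := by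
  obtain ⟨hA, jQ, jU, hinjQ, hsurjQ, -, -⟩ := exists_dualBases_primaryTorsion W p
  have hloc := fun v (hv : v ∈ S) ↦
    localH0_and_LOC1_primaryTorsion S W hS κ ρ₀ (Sum.inr v) (hsup v hv).choose (hsup v hv).choose_spec
  exact bigRep_leo_crk_of_dualBasis_ofTate hS κ ρ₀ h41 h42 h5A h32 hSf hK hA jQ hinjQ hsurjQ
    (fun v hv ↦ (hloc v hv).1) (fun v hv ↦ (hloc v hv).2) hne hp𝔭 hp𝔭bar hSel

/-- **[T28 `OfTate` re-typing: Greenberg 2006 Prop. 3.2 by name ↦ Milne ADT I Thm. 5.1 by name (Prop. 3.2 is read in degrees ≤ 2 only, `prop32_global_le_two_of_tate`).]** [cite: MilneADT2006, I Thm. 5.1 (p. 67)] **SUR(`𝐃_E`, `𝓛_𝔭`) — Greenberg 2016 Prop. 2.6.3 (c) for `𝐃_E = E[p^∞] ⊗ Λ^*(κ⁻¹)`**: for an elliptic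
`W/K`, `K` imaginary quadratic, `p = 𝔭𝔭̄`, `S ⊇ {w ∣ p}` finite with a `σ`-supply (no place of `S` splits
completely in `K_∞`), and ANY continuous `ℤ_p`-linear `ρ₀` of `G_{K,S}` on `E[p^∞]`, the global-to-local map
`φ_{𝓛_𝔭} : H¹(K_Σ/K, 𝐃_E) → ∏_{w∈Σ} H¹(K_w, 𝐃_E)/L_w` (`L_𝔭 = ⊤`, `L_w = 0` else) IS SURJECTIVE, granted the
five published facts by name and `corank_Λ S_{𝓛_𝔭}(K, 𝐃_E) = 0`. With `…SurOfSUR` this is the V21 road's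
SUR_f at `v̄` (`U(E[p^∞]) ↠ ⊕_{j<s} H¹(K_{∞,w_j}, E[p^∞])`), modulo that one input.
[cite: Greenberg2016Selmer, Prop. 2.6.3 (c) (§2.6 p. 10), §4.3 pp. 20–21] [cite: Greenberg2010, Prop. 3.2.1, Lemma 5.2.2]
[cite: PollackWeston2011, App. A Prop. A.2 (the same surjectivity, r_v = 2)] -/
theorem primaryTorsion_fullAt_SUR_ofTate (h263 : prop263_sur_of_crk) (h41 : prop41_globalEulerPoincareCorank)
    (h42 : prop42_localEulerPoincareCorank) (h5A : sec5A_localH2_subsingleton_of_LOC1)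
    (h32 : (∀ (L : Type) [Field L] [NumberField L], Literature.NumberTheory.GaloisCohomology.tateGlobalEulerPoincareCharacteristic L))
    (hSf : S.Finite) (hK : IsImaginaryQuadratic K)
    (hsup : ∀ v : HeightOneSpectrum (𝓞 K), v ∈ S →
      ∃ σ : absoluteGaloisGroup (Place.Completion (Sum.inr v : Place K)),
        κ (absGaloisRestrict K _ σ) ≠ 1)
    {𝔭 𝔭bar : HeightOneSpectrum (𝓞 K)} (hne : 𝔭bar ≠ 𝔭)
    (hp𝔭 : ((p : ℕ) : 𝓞 K) ∈ 𝔭.asIdeal) (hp𝔭bar : ((p : ℕ) : 𝓞 K) ∈ 𝔭bar.asIdeal)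
    (hSel : HasCorank (PowerSeries ℤ_[p])
      (fullAtSpecification S (bigRep (κ.liftUnramifiedOutside S hS) ρ₀) (Sum.inr 𝔭)).selmer 0) :
    (fullAtSpecification S (bigRep (κ.liftUnramifiedOutside S hS) ρ₀) (Sum.inr 𝔭)).SUR := by
  obtain ⟨hA, jQ, jU, hinjQ, hsurjQ, -, -⟩ := exists_dualBases_primaryTorsion W p
  have hloc := fun v (hv : v ∈ S) ↦
    localH0_and_LOC1_primaryTorsion S W hS κ ρ₀ (Sum.inr v) (hsup v hv).choose (hsup v hv).choose_spec
  exact bigRep_fullAt_SUR_of_dualBasis_ofTate hS κ ρ₀ h263 h41 h42 h5A h32 hSf hK hA jQ hinjQ hsurjQ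
    (fun v hv ↦ (hloc v hv).1) (fun v hv ↦ (hloc v hv).2) hne hp𝔭 hp𝔭bar hSel

end CurveSUR

end Summit.BirchSwinnertonDyer.BirchSwinnertonDyer.Theorems.AcTwistDeformation

end
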